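import Mathlib
import Literature.Computability.Complexity.AvgPRel
import Literature.Computability.Complexity.AlmostPProofs
import Literature.Computability.Complexity.CoinCounting
import Literature.Computability.MetaComplexity.HeuristicClassesProofs

/-!
# Crux `RandomOracleHeurSeparation` (stmt-QuantumAdvantage-1131, route SosSandwich), line `birth` —
# stub `stub_almostAvgP_heur`, part 1: the error events of one oracle machine under the random oracle

Measure-theoretic half of the average-case Bennett–Gill argument (ALMOST-`AvgP ⊆ ⋂_{δ>0} Heur_δBPP`),
for ONE transcript oracle machine `M` (G01 `OracleAlg`) with round budget `q` and a language `L`: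

* §1 `wrongAt L M q x` — the event "`M^A` does not output `[x ∈ L]` on `x`" (determined by finitely many
  oracle bits, hence measurable); `err L M q A n` — Aaronson–Ambainis' error fraction of `M^A` at length
  `n` (`errFraction`), a measurable simple function of `A` (`err_eq_sum_indicator`, `measurable_err`); the
  tail events `tail c N = {∀ n ≥ N, err ≤ c}` and the good event `good = ⋂_k ⋃_N tail (1/(k+1)) N`
  (error fraction `→ 0`), both measurable.
* §2 `exists_machine_pos` — countable pigeonhole: if `L ∈ AvgP^A` almost surely then some polynomial-time
  `(M, q)` witnesses it on a set of positive measure; `wit_subset_good` — capping the queries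
  (`OracleAlg.capQ`) keeps the witness event inside the good event of the capped machine.
* §3 `uniformProb_run_mul_measureReal`, `uniformProb_ne_mul_measureReal` — the lazy-sampling identity in
  exact conditional form: the coin probability that the simulation of `M` (table `τ` hard-wired) outputs
  `b` (resp. does not output `c`) equals `μ(event ∩ cylinder of τ) / μ(cylinder)`.
* §5a the parametrised lift `(x, 1ⁿ) ↦ A(x)` of a randomized algorithm (`paramLift`, adapted from
  `Theorems/AvgFaceBeyondPrior/Negative/AvgFaceBeyondPriorNecessary.lean`, re-proved here to keep the import
  cone free of other route files).
* §4 `sum_measure_wrongAt_inter_le` — on a measurable set where `err ≤ c` at length `n`, the `2ⁿ`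
  wrong-answer events have total measure `≤ 2ⁿ·c·μ(set)` (integrate the count of wrong answers).

Part 2 (`…StubAlmostAvgPHeur.lean`) builds the heuristic algorithm and closes the registered stub.
Toolkit: `AlmostPProofs.lean` (ALMOST-`P ⊆ BPP`), `RandomOracleCylinders.lean`, `LazySampling*.lean`.
Sources: BennettGill1981 Thm. 5; BookVollmerWagner1996 §3 Prop. 1–2, §4 Thm. 3; AaronsonAmbainis2014 §1
p. 5 (AvgP); BogdanovTrevisan2006 Def. 2.13.
-/

-- D-0017: single-conjunct summit ⇒ the duplicate `QuantumAdvantage.QuantumAdvantage` is mandated.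
set_option linter.dupNamespace false

noncomputable section

namespace Summit.QuantumAdvantage.QuantumAdvantage.Cruxes.RandomOracleHeurSeparation.Birth

open MeasureTheory Filter Finset
open Literature.Computability.Complexity Literature.Computability.Complexity.OracleAlg
open Literature.Computability.QuantumComplexity
open Literature.Computability.MetaComplexity (paramEnc map_take_uniformOfFintype_vector polynomial_eval_mono
  dropParamsMachine outputsWithin_dropParamsMachine)
open scoped ENNReal

namespace StubAlmostAvgPHeur

/-! ### §1 The error events of one machine and their measurability -/

section Machine

variable (L : Language Bool) (M : OracleAlg Bool) (q : Polynomial ℕ)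

/-- The answer function of the machine `M` (round budget `q`) relative to the oracle `A`. [folklore] -/
def ans (A : Set (List Bool)) : List Bool → Option Bool :=
  fun x => M.run (Oracle.ofLanguage A) (q.eval x.length) x

/-- The error fraction of `M^A` for `L` at length `n`. [cite: AaronsonAmbainis2014, §1 (p. 5, AvgP)] -/
def err (A : Set (List Bool)) (n : ℕ) : ℝ := errFraction L (ans M q A) n

/-- The event "`M^A` does not output `[x ∈ L]` on `x`" (in `runWith` form). [folklore] -/
def wrongAt (x : List Bool) : Set (Set (List Bool)) :=
  {A | runWith M x (fun _ u => A.boolIndicator u) (q.eval x.length) [] ≠ some (L.boolIndicator x)}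

/-- Membership in the wrong-answer event. [folklore] -/
theorem mem_wrongAt_iff (x : List Bool) (A : Set (List Bool)) :
    A ∈ wrongAt L M q x ↔ ans M q A x ≠ some (L.boolIndicator x) := by
  simp only [wrongAt, Set.mem_setOf_eq, ans, run_ofLanguage_eq_runWith]

/-- The wrong-answer event reads finitely many oracle bits, hence is measurable. [folklore] -/
theorem measurableSet_wrongAt (x : List Bool) : MeasurableSet (wrongAt L M q x) := by
  have h := (isDetermined_runEvent M x (q.eval x.length) ∅ (L.boolIndicator x)).compl
  have hEq : wrongAt L M q x =
      {A : Set (List Bool) | runWith M x (fun _ u => A.boolIndicator u) (q.eval x.length) [] =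
        some (L.boolIndicator x)}ᶜ := by
    ext A; simp [wrongAt]
  rw [hEq]
  exact h.measurableSet

/-- The error fraction as an average of indicators of the wrong-answer events. [folklore] -/
theorem err_eq_sum_indicator (A : Set (List Bool)) (n : ℕ) :
    err L M q A n =
      (∑ v : List.Vector Bool n, (wrongAt L M q v.toList).indicator (fun _ => (1 : ℝ)) A) / 2 ^ n := by
  classical
  unfold err errFraction
  congr 1
  rw [Finset.card_filter]
  push_cast
  refine Finset.sum_congr rfl fun v _ => ?_
  by_cases h : ans M q A v.toList ≠ some (L.boolIndicator v.toList)
  · have hA : A ∈ wrongAt L M q v.toList := (mem_wrongAt_iff L M q _ A).2 h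
    simp [h, hA]
  · have hA : A ∉ wrongAt L M q v.toList := fun hA => h ((mem_wrongAt_iff L M q _ A).1 hA)
    simp [hA, h]

/-- The error fraction at a fixed length is a measurable function of the oracle. [folklore] -/
theorem measurable_err (n : ℕ) : Measurable (fun A => err L M q A n) := by
  have h : (fun A => err L M q A n) = fun A =>
      (∑ v : List.Vector Bool n, (wrongAt L M q v.toList).indicator (fun _ => (1 : ℝ)) A) / 2 ^ n :=
    funext fun A => err_eq_sum_indicator L M q A n
  rw [h]
  refine Measurable.div_const ?_ _
  exact Finset.measurable_sum _ fun v _ => measurable_const.indicator (measurableSet_wrongAt L M q v.toList)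

/-- The tail event: from length `N` on, the error fraction is at most `c`. [folklore] -/
def tail (c : ℝ) (N : ℕ) : Set (Set (List Bool)) := {A | ∀ n, N ≤ n → err L M q A n ≤ c}

/-- The tail events are measurable. [folklore] -/
theorem measurableSet_tail (c : ℝ) (N : ℕ) : MeasurableSet (tail L M q c N) := by
  have h : tail L M q c N = ⋂ n : ℕ, {A | N ≤ n → err L M q A n ≤ c} := by
    ext A; simp [tail]
  rw [h]
  refine MeasurableSet.iInter fun n => ?_
  by_cases hn : N ≤ n
  · have h1 : {A : Set (List Bool) | N ≤ n → err L M q A n ≤ c} = {A | err L M q A n ≤ c} := by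
      ext A; simp [hn]
    rw [h1]
    exact measurableSet_le (measurable_err L M q n) measurable_const
  · have h1 : {A : Set (List Bool) | N ≤ n → err L M q A n ≤ c} = Set.univ := by
      ext A; simp [hn]
    rw [h1]
    exact MeasurableSet.univ

/-- The tail events increase with `N`. [folklore] -/
theorem tail_mono (c : ℝ) {N N' : ℕ} (h : N ≤ N') : tail L M q c N ⊆ tail L M q c N' :=
  fun _ hA n hn => hA n (h.trans hn)

/-- The good event: the error fraction tends to `0` (written as `∀ k ∃ N ∀ n ≥ N, err ≤ 1/(k+1)`). [folklore] -/
def good : Set (Set (List Bool)) := ⋂ k : ℕ, ⋃ N : ℕ, tail L M q (1 / ((k : ℝ) + 1)) N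

/-- The good event is measurable. [folklore] -/
theorem measurableSet_good : MeasurableSet (good L M q) :=
  MeasurableSet.iInter fun _ => MeasurableSet.iUnion fun N => measurableSet_tail L M q _ N

/-- An oracle whose error fraction tends to `0` is good. [folklore] -/
theorem mem_good_of_tendsto {A : Set (List Bool)}
    (h : Tendsto (fun n => err L M q A n) atTop (nhds 0)) : A ∈ good L M q := by
  simp only [good, Set.mem_iInter, Set.mem_iUnion]
  intro k
  have hk : (0 : ℝ) < 1 / ((k : ℝ) + 1) := by positivity
  obtain ⟨N, hN⟩ := eventually_atTop.1 ((tendsto_order.1 h).2 _ hk)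
  exact ⟨N, fun n hn => (hN n hn).le⟩

end Machine

/-! ### §2 Countable pigeonhole over the machines (Bennett–Gill, step 1) -/

/-- The witness event of `(M, q)` for `L ∈ AvgP^A`: the query bound holds and the error fraction tends
to `0` (the defining clause of `AvgPRel`). [cite: AaronsonAmbainis2014, §1 (p. 5)] -/
def Wit (L : Language Bool) (M : OracleAlg Bool) (q : Polynomial ℕ) (A : Set (List Bool)) : Prop :=
  (∀ x : List Bool, ∀ y ∈ M.queries (Oracle.ofLanguage A) (q.eval x.length) x, y.length ≤ q.eval x.length) ∧
    Tendsto (fun n => errFraction L (fun x => M.run (Oracle.ofLanguage A) (q.eval x.length) x) n)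
      atTop (nhds 0)

/-- **Step 1 (countable pigeonhole).** If `L ∈ AvgP^A` almost surely, some polynomial-time machine with
some polynomial budget witnesses it on a set of oracles of positive (outer) measure.
[cite: BookVollmerWagner1996, §4 Thm. 3 (p. 374)] -/
theorem exists_machine_pos {L : Language Bool}
    (hL : ∀ᵐ (A : Set (List Bool)) ∂randomOracleMeasure, L ∈ AvgPRel (Oracle.ofLanguage A)) :
    ∃ (M : OracleAlg Bool) (q : Polynomial ℕ), M.IsPolyTime Computability.encodingBoolBool ∧
      randomOracleMeasure {A | Wit L M q A} ≠ 0 := by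
  haveI : Countable (Polynomial ℕ) := countable_polynomial_nat
  haveI : Countable {M : OracleAlg Bool // M.IsPolyTime Computability.encodingBoolBool} :=
    (countable_setOf_isPolyTime Computability.encodingBoolBool).to_subtype
  set gd : {M : OracleAlg Bool // M.IsPolyTime Computability.encodingBoolBool} × Polynomial ℕ →
      Set (Set (List Bool)) := fun i => {A | Wit L i.1.1 i.2 A} with hgd
  have h0 : randomOracleMeasure {A : Set (List Bool) | ¬ L ∈ AvgPRel (Oracle.ofLanguage A)} = 0 :=
    ae_iff.1 hL
  have hcover : {A : Set (List Bool) | L ∈ AvgPRel (Oracle.ofLanguage A)} ⊆ ⋃ i, gd i := by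
    intro A hA
    obtain ⟨M, hM, q, hq, ht⟩ := mem_AvgPRel_iff.1 hA
    exact Set.mem_iUnion.2 ⟨(⟨M, hM⟩, q), ⟨hq, ht⟩⟩
  have h1 : randomOracleMeasure (⋃ i, gd i) ≠ 0 := by
    intro h
    have hle : randomOracleMeasure Set.univ ≤
        randomOracleMeasure (⋃ i, gd i) +
          randomOracleMeasure {A | ¬ L ∈ AvgPRel (Oracle.ofLanguage A)} := by
      refine (measure_mono fun A _ => ?_).trans (measure_union_le _ _)
      by_cases hA : L ∈ AvgPRel (Oracle.ofLanguage A)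
      · exact Or.inl (hcover hA)
      · exact Or.inr hA
    rw [h, h0, add_zero, measure_univ] at hle
    exact one_ne_zero (le_antisymm hle bot_le)
  obtain ⟨i, hi⟩ : ∃ i, randomOracleMeasure (gd i) ≠ 0 := by
    by_contra h
    push Not at h
    exact h1 (measure_iUnion_null_iff.2 h)
  exact ⟨i.1.1, i.2, i.1.2, hi⟩

/-- **Step 2 (capping).** On the witness event the capped machine `M.capQ q false` runs as `M`, so its
error fraction tends to `0`: the witness event lies in the (measurable) good event of the capped machine.
[folklore] -/
theorem wit_subset_good (L : Language Bool) (M : OracleAlg Bool) (q : Polynomial ℕ) :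
    {A | Wit L M q A} ⊆ good L (M.capQ q false) q := by
  rintro A ⟨hq, ht⟩
  apply mem_good_of_tendsto
  have heq : (fun n => err L (M.capQ q false) q A n) =
      fun n => errFraction L (fun x => M.run (Oracle.ofLanguage A) (q.eval x.length) x) n := by
    funext n
    unfold err ans
    congr 1
    funext x
    exact (run_capQ M q false (Oracle.ofLanguage A) x (q.eval x.length) (hq x)).1
  rw [heq]
  exact ht

/-! ### §3 Lazy sampling: coin probabilities are conditional measures (exact form) -/

/-- **Lazy sampling, exact form.** The probability over the coins that the lazy-sampling simulation of
`M` on `x` (table `τ` on `F`) outputs `b` within `k` rounds, times the measure of the cylinder of `τ`, is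
the measure of "`M^A` outputs `b`" inside that cylinder. [cite: BookVollmerWagner1996, §3 Prop. 1–2 (p. 373–374)] -/
theorem uniformProb_run_mul_measureReal (M : OracleAlg Bool) (x : List Bool) (k : ℕ)
    (F : Finset (List Bool)) (τ : F → Bool) (b : Bool) :
    uniformProb k {y | runWith M x (coinAns M F τ x y) k [] = some b} *
        randomOracleMeasure.real (oracleCylinder F τ) =
      randomOracleMeasure.real
        ({A | runWith M x (fun _ u => A.boolIndicator u) k [] = some b} ∩ oracleCylinder F τ) := by
  classical
  rw [uniformProb_lazySampling, measureReal_def, measureReal_def, runEvent_inter_oracleCylinder,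
    randomOracleMeasure_restrictBool, oracleCylinder_eq_preimage_tables M x k F τ,
    randomOracleMeasure_restrictBool, ENNReal.toReal_mul, ENNReal.toReal_mul, ENNReal.toReal_natCast,
    ENNReal.toReal_natCast]
  have hT : ((tables (queryBound M x k F) F τ).card : ℝ) ≠ 0 :=
    Nat.cast_ne_zero.2 (card_tables_ne_zero (subset_queryBound M x k F))
  field_simp

/-- The wrong-output probability of the simulation, times the measure of the cylinder, is the measure of
the wrong-answer event inside the cylinder. [folklore] -/
theorem uniformProb_ne_mul_measureReal (M : OracleAlg Bool) (x : List Bool) (k : ℕ)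
    (F : Finset (List Bool)) (τ : F → Bool) (c : Bool) :
    uniformProb k {y | runWith M x (coinAns M F τ x y) k [] ≠ some c} *
        randomOracleMeasure.real (oracleCylinder F τ) =
      randomOracleMeasure.real
        ({A | runWith M x (fun _ u => A.boolIndicator u) k [] ≠ some c} ∩ oracleCylinder F τ) := by
  have h1 := uniformProb_run_mul_measureReal M x k F τ c
  have hc : {y : List Bool | runWith M x (coinAns M F τ x y) k [] ≠ some c} =
      {y | runWith M x (coinAns M F τ x y) k [] = some c}ᶜ := by
    ext y; simp
  have hmeas : MeasurableSet
      {A : Set (List Bool) | runWith M x (fun _ u => A.boolIndicator u) k [] = some c} :=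
    (isDetermined_runEvent M x k ∅ c).measurableSet
  have hsplit := measureReal_inter_add_sdiff (μ := randomOracleMeasure) (s := oracleCylinder F τ) hmeas
  have hdiff : oracleCylinder F τ \
      {A : Set (List Bool) | runWith M x (fun _ u => A.boolIndicator u) k [] = some c} =
      {A | runWith M x (fun _ u => A.boolIndicator u) k [] ≠ some c} ∩ oracleCylinder F τ := by
    ext A
    simp only [Set.mem_sdiff, Set.mem_setOf_eq, Set.mem_inter_iff]
    exact and_comm
  rw [hdiff, Set.inter_comm] at hsplit
  rw [hc, uniformProb_compl]
  linarith

/-! ### §4 The simple-function bound: few wrong answers on the tail event -/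

/-- On a measurable set where the error fraction at length `n` is at most `c`, the wrong-answer events of
the `2ⁿ` inputs have total measure at most `2ⁿ·c` times the measure of the set (integrate the count).
[folklore] -/
theorem sum_measure_wrongAt_inter_le (L : Language Bool) (M : OracleAlg Bool) (q : Polynomial ℕ)
    {n : ℕ} {S : Set (Set (List Bool))} (hS : MeasurableSet S) {c : ℝ}
    (hbound : ∀ A ∈ S, err L M q A n ≤ c) :
    ∑ v : List.Vector Bool n, randomOracleMeasure (wrongAt L M q v.toList ∩ S) ≤
      ENNReal.ofReal (2 ^ n * c) * randomOracleMeasure S := by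
  classical
  have hW : ∀ v : List.Vector Bool n, MeasurableSet (wrongAt L M q v.toList) :=
    fun v => measurableSet_wrongAt L M q v.toList
  calc ∑ v : List.Vector Bool n, randomOracleMeasure (wrongAt L M q v.toList ∩ S)
      = ∑ v : List.Vector Bool n,
          ∫⁻ A in S, (wrongAt L M q v.toList).indicator 1 A ∂randomOracleMeasure := by
        refine Finset.sum_congr rfl fun v _ => ?_
        rw [lintegral_indicator_one (hW v), Measure.restrict_apply (hW v)]
    _ = ∫⁻ A in S, ∑ v : List.Vector Bool n, (wrongAt L M q v.toList).indicator 1 A ∂randomOracleMeasure :=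
        (lintegral_finsetSum _ fun v _ => measurable_one.indicator (hW v)).symm
    _ ≤ ∫⁻ _ in S, ENNReal.ofReal (2 ^ n * c) ∂randomOracleMeasure := by
        refine setLIntegral_mono' hS fun A hA => ?_
        have hsum : ∑ v : List.Vector Bool n,
            (wrongAt L M q v.toList).indicator (1 : Set (List Bool) → ℝ≥0∞) A =
            ((Finset.univ.filter fun v : List.Vector Bool n => A ∈ wrongAt L M q v.toList).card : ℝ≥0∞) := by
          rw [Finset.card_filter]
          push_cast
          refine Finset.sum_congr rfl fun v _ => ?_
          by_cases hv : A ∈ wrongAt L M q v.toList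
          · simp [hv]
          · simp [hv]
        have hcard : (((Finset.univ.filter fun v : List.Vector Bool n =>
            A ∈ wrongAt L M q v.toList).card : ℕ) : ℝ) ≤ 2 ^ n * c := by
          have h := hbound A hA
          unfold err errFraction at h
          rw [div_le_iff₀ (by positivity)] at h
          have hset : (Finset.univ.filter fun v : List.Vector Bool n =>
                ans M q A v.toList ≠ some (L.boolIndicator v.toList)) =
              (Finset.univ.filter fun v : List.Vector Bool n => A ∈ wrongAt L M q v.toList) := by
            refine Finset.filter_congr fun v _ => ?_
            rw [mem_wrongAt_iff]
          rw [hset] at h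
          linarith
        rw [hsum]
        calc (((Finset.univ.filter fun v : List.Vector Bool n => A ∈ wrongAt L M q v.toList).card : ℕ) : ℝ≥0∞)
            = ENNReal.ofReal (((Finset.univ.filter fun v : List.Vector Bool n =>
                A ∈ wrongAt L M q v.toList).card : ℕ) : ℝ) := (ENNReal.ofReal_natCast _).symm
          _ ≤ ENNReal.ofReal (2 ^ n * c) := ENNReal.ofReal_le_ofReal hcard
    _ = ENNReal.ofReal (2 ^ n * c) * randomOracleMeasure S := setLIntegral_const _ _

/-- Real form of `sum_measure_wrongAt_inter_le`. [folklore] -/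
theorem sum_measureReal_wrongAt_inter_le (L : Language Bool) (M : OracleAlg Bool) (q : Polynomial ℕ)
    {n : ℕ} {S : Set (Set (List Bool))} (hS : MeasurableSet S) {c : ℝ} (hc : 0 ≤ c)
    (hbound : ∀ A ∈ S, err L M q A n ≤ c) :
    ∑ v : List.Vector Bool n, randomOracleMeasure.real (wrongAt L M q v.toList ∩ S) ≤
      2 ^ n * c * randomOracleMeasure.real S := by
  have h := sum_measure_wrongAt_inter_le L M q hS hbound
  have hne : ∀ v : List.Vector Bool n, randomOracleMeasure (wrongAt L M q v.toList ∩ S) ≠ ⊤ :=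
    fun v => measure_ne_top _ _
  have h2 := ENNReal.toReal_mono
    (ENNReal.mul_ne_top ENNReal.ofReal_ne_top (measure_ne_top _ _)) h
  rw [ENNReal.toReal_sum (fun v _ => hne v), ENNReal.toReal_mul,
    ENNReal.toReal_ofReal (mul_nonneg (by positivity) hc)] at h2
  simpa only [measureReal_def] using h2


/-! ### §5a The parametrised lift of a randomized algorithm (adapted from `AvgFaceBeyondPriorNecessary.lean`) -/

section ParamLift

variable {β Γ₁ : Type}

/-- Lift of a randomized algorithm on strings to parametrised inputs `(x, 1ⁿ)`, ignoring `n`.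
[cite: BogdanovTrevisan2006, §2.3] -/
def paramLift (A : RandAlg (List Bool) β) : RandAlg (List Bool × ℕ) β where
  run p r := A.run p.1 r
  coinLen := A.coinLen

-- adapted from Summits/QuantumAdvantage/QuantumAdvantage/Theorems/AvgFaceBeyondPrior/Negative/AvgFaceBeyondPriorNecessary.lean
/-- Output distribution of the lift = that of `A` on `x` (coin-oblivious `A` with an exactly polynomial
coin budget). [cite: BogdanovTrevisan2006, §2.3] -/
theorem outputPMF_paramLift (A : RandAlg (List Bool) β)
    (hq : ∃ q : Polynomial ℕ, ∀ n, A.coinLen n = q.eval n)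
    (hobl : ∀ x r, A.run x r = A.run x (r.take (A.coinLen x.length))) (x : List Bool) (n : ℕ) :
    (paramLift A).outputPMF paramEnc (x, n) = A.outputPMF id x := by
  obtain ⟨q, hq⟩ := hq
  have hlen : x.length ≤ (paramEnc (x, n)).length := by
    simp only [paramEnc, length_boolPair]
    omega
  have hle : A.coinLen x.length ≤ A.coinLen (paramEnc (x, n)).length := by
    rw [hq, hq]
    exact polynomial_eval_mono q hlen
  simp only [RandAlg.outputPMF, paramLift, id]
  have h1 :
      (fun r : List.Vector Bool (A.coinLen (paramEnc (x, n)).length) => A.run x r.toList) =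
      (fun s : List Bool => A.run x s) ∘ fun r => r.toList.take (A.coinLen x.length) := by
    funext r
    exact hobl x r.toList
  have h2 : (fun r : List.Vector Bool (A.coinLen x.length) => A.run x r.toList) =
      (fun s : List Bool => A.run x s) ∘ List.Vector.toList := rfl
  rw [h1, h2, ← PMF.map_comp, ← PMF.map_comp, map_take_uniformOfFintype_vector hle]

/-- Probabilities under the lift. [folklore] -/
theorem pr_paramLift (A : RandAlg (List Bool) β)
    (hq : ∃ q : Polynomial ℕ, ∀ n, A.coinLen n = q.eval n)
    (hobl : ∀ x r, A.run x r = A.run x (r.take (A.coinLen x.length))) (x : List Bool) (n : ℕ)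
    (E : Set β) : (paramLift A).pr paramEnc (x, n) E = A.pr id x E := by
  simp only [RandAlg.pr, outputPMF_paramLift A hq hobl]

/-- The lift is probabilistic polynomial time: dropping the unary parameter, `(⟨x, 1ⁿ⟩, r) ↦ (x, r)`, is
computed by the tree's `dropParamsMachine` in `|input|` steps, then compose. [cite: AroraBarak2009, Thm. 2.8 (proof)] -/
theorem isPolyTime_paramLift {eb : β → List Γ₁} {A : RandAlg (List Bool) β}
    (hA : A.IsPolyTime id eb) : (paramLift A).IsPolyTime paramEnc eb := by
  have hdrop : PolyTimeComputable (fun p : (List Bool × ℕ) × List Bool => boolPair (paramEnc p.1) p.2)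
      (Function.uncurry boolPair) (fun p : (List Bool × ℕ) × List Bool => (p.1.1, p.2)) := by
    refine ⟨Polynomial.X, dropParamsMachine, fun p => ?_⟩
    simp only [Polynomial.eval_X, paramEnc, Function.uncurry]
    exact outputsWithin_dropParamsMachine p.1.1 _ p.2
  exact ⟨PolyTimeComputable.comp_holds hA.1 hdrop, hA.2⟩

end ParamLift

end StubAlmostAvgPHeur

end Summit.QuantumAdvantage.QuantumAdvantage.Cruxes.RandomOracleHeurSeparation.Birth

end
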